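import Mathlib
import HarnessLib
import Summits.QuantumFields.YangMills.Theorems.HypercubicLimit.Negative.ReflectedDensity
import Summits.QuantumFields.YangMills.Theorems.FradkinShenkerFlowFiniteSusceptibilityWeakCouplingRPCauchySchwarz
import Literature.MathematicalPhysics.AQFT.OSAxiomsSchwinger
import Literature.MathematicalPhysics.QuantumLattice.LatticeScalarField
import Literature.MathematicalPhysics.QuantumFieldTheory.LatticeGaugeStaticPotentialProofs
import Literature.Probability.LatticeModels.ThermodynamicLimit
import Summits.QuantumFields.YangMills.Theorems.PencilRigidityHypercubicLimitRpBlockMomentTheta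
import Summits.QuantumFields.YangMills.Theorems.PencilRigidityHypercubicLimitRpBlockMomentPerm
import Summits.QuantumFields.YangMills.Theorems.PencilRigidityHypercubicLimitRpBlockHermitian
import Summits.QuantumFields.YangMills.Theorems.PencilRigidityHypercubicLimitRpBlockReflectionPositive

/-!
# c1 blocks for the closure of line `conditional-mean-telescoping` (crux stmt-QuantumFields-8646)

Reflection / symmetry legs of `stub_closure` at the LATTICE level, stated def-free over tree objects
(`torusPlaquette` of `Theorems/HypercubicLimit/Negative/ReflectedDensity.lean`, `wilsonMeasure`,
`GaugeConfig.timeReflect`, `box`, `siteToE`, `LabelledSchwingerFamily.evalAt`).  The RP-ADAPTED lattice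
family places the plaquette `(q, x)` (orientation `q = (i<j)`, corner `x ∈ ℤ⁴`) at the physical point
`a • (x + (e_i + e_j)/2 − e₀/2)` (its centre, in the frame where the odd-torus bond reflection `t ↦ 1 − t`
is `t ↦ −t`), and sums temporal corners over `box 4 L`, spatial corners over the time range `[1 − L, L]`
(the unique Θ-symmetric choices).  Each statement below is registered as a sub-goal (`workitem stub-add`);
ALL FOUR ARE LANDED (wave 1, 2026-08-16): `rpBlock_momentTheta` p97347, `rpBlock_momentPerm` p97485,
`rpBlock_hermitian` p98027, `rpBlock_reflectionPositive` p100580 (files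
`Theorems/PencilRigidityHypercubicLimitRpBlock{MomentTheta,MomentPerm,Hermitian,ReflectionPositive}.lean`,
imported above); the `example`s re-check the registered statements against the tree theorems by name.
-/

noncomputable section

open scoped SchwartzMap ComplexConjugate
open MeasureTheory
open Literature.MathematicalPhysics.AQFT Literature.MathematicalPhysics.QuantumLattice
open Literature.MathematicalPhysics.QuantumFieldTheory
open Literature.Probability.LatticeModels (box Site)
open Summit.QuantumFields.YangMills.Theorems.HypercubicLimit.Negative (torusPlaquette thetaZ)

namespace Summit.QuantumFields.YangMills.Cruxes.HypercubicLimit.ConditionalMeanTelescoping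

/-- **Block M-θ (moment identity under the odd-torus reflection).** For plaquette strings of
orientations `q k = (i<j)` the centred torus moment is invariant under the corner map of the bond
reflection `Θ : t ↦ 1 − t`: temporal corners go to `θ_ℤ x − e₀`, spatial ones to `θ_ℤ x`
(`torusPlaquette_timeReflect_temporal/_spatial` + `Θ`-invariance of Wilson's torus measure). -/
example :
    ∀ (G : Type) [Group G] [TopologicalSpace G] [IsTopologicalGroup G] [CompactSpace G]
      [MeasurableSpace G] [BorelSpace G] (r : LatticeRep G) (β : ℝ) (L n : ℕ)
      (q : Fin n → Fin 4 × Fin 4) (m : Fin n → ℝ) (x : Fin n → (Fin 4 → ℤ)),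
      (∀ k, (q k).1 < (q k).2) →
        (∫ U, ∏ k, (torusPlaquette r (2 * L + 1) (q k).1 (q k).2 (x k) U - m k)
            ∂(wilsonMeasure r.ρ β : Measure (GaugeConfig 4 (2 * L + 1) G))) =
          ∫ U, ∏ k, (torusPlaquette r (2 * L + 1) (q k).1 (q k).2
              (if (q k).1 = 0 then thetaZ (x k) - Pi.single 0 1 else thetaZ (x k)) U - m k)
            ∂(wilsonMeasure r.ρ β : Measure (GaugeConfig 4 (2 * L + 1) G)) :=
  rpBlock_momentTheta

/-- **Block M-π (moment identity under coordinate permutations).** The centred torus moment of a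
plaquette string is invariant under a simultaneous permutation `π` of the coordinate axes: orientation
`(i, j) ↦ (π i, π j)`, corner `x ↦ π·x` with `(π·x) i = x (π⁻¹ i)` (tree `configPerm`, `sitePerm`,
`wilsonMeasure_map_configPerm`). -/
example :
    ∀ (G : Type) [Group G] [TopologicalSpace G] [IsTopologicalGroup G] [CompactSpace G]
      [MeasurableSpace G] [BorelSpace G] (r : LatticeRep G) (β : ℝ) (L n : ℕ)
      (π : Equiv.Perm (Fin 4)) (q : Fin n → Fin 4 × Fin 4) (m : Fin n → ℝ) (x : Fin n → (Fin 4 → ℤ)),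
        (∫ U, ∏ k, (torusPlaquette r (2 * L + 1) (q k).1 (q k).2 (x k) U - m k)
            ∂(wilsonMeasure r.ρ β : Measure (GaugeConfig 4 (2 * L + 1) G))) =
          ∫ U, ∏ k, (torusPlaquette r (2 * L + 1) (π (q k).1) (π (q k).2)
              (fun i => x k (π.symm i)) U - m k)
            ∂(wilsonMeasure r.ρ β : Measure (GaugeConfig 4 (2 * L + 1) G)) :=
  rpBlock_momentPerm

/-- **Block E0-herm (exact lattice hermiticity of the RP-adapted family).** The RP-adapted lattice
`n`-point distributions `F ↦ λⁿ ∑_q ∑_x W_q(x) F(centres)` form a `SchwingerFamily` that is EXACTLY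
hermitian in the OS sense (`S n F = conj (S n (Θ F*))` for time-ordered `F`): reindex by the corner
reflection (temporal `x₀ ↦ −x₀` on `box`, spatial `x₀ ↦ 1 − x₀` on `[1−L, L]`), use
`torusPlaquette_timeReflect_*`, `Θ`-invariance of the torus state and reality of the weights. -/
example :
    ∀ (G : Type) [Group G] [TopologicalSpace G] [IsTopologicalGroup G] [CompactSpace G]
      [MeasurableSpace G] [BorelSpace G] (r : LatticeRep G) (β : ℝ) (L : ℕ) (a lam : ℝ)
      (m : {q : Fin 4 × Fin 4 // q.1 < q.2} → ℝ),
      (SchwingerFamily.toLabelled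
        ((fun n => ∑ q : Fin n → {q : Fin 4 × Fin 4 // q.1 < q.2},
            ∑ x ∈ Fintype.piFinset (fun k => if (q k).1.1 = 0 then box 4 L
                else (box 4 L).filter (fun y => 1 - (L : ℤ) ≤ y 0)),
              (((lam ^ n * ∫ U, ∏ k, (torusPlaquette r (2 * L + 1) (q k).1.1 (q k).1.2 (x k) U - m (q k))
                  ∂(wilsonMeasure r.ρ β : Measure (GaugeConfig 4 (2 * L + 1) G)) : ℝ) : ℂ)) •
                LabelledSchwingerFamily.evalAt (fun k => a • (siteToE (x k) +
                  (2⁻¹ : ℝ) • (EuclideanSpace.single (q k).1.1 (1 : ℝ) + EuclideanSpace.single (q k).1.2 (1 : ℝ)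
                    - EuclideanSpace.single 0 (1 : ℝ))))) :
          SchwingerFamily (EuclideanSpace ℝ (Fin 4)))).IsHermitian :=
  rpBlock_hermitian

/-- **Block E2-lat (exact Osterwalder–Seiler positivity of the RP-adapted family).** For `β ≥ 0`,
`L ≥ 1`, `a > 0` the RP-adapted lattice family is EXACTLY reflection positive in the OS sense
(`IsReflectionPositive`, finite sequences of time-ordered test functions): after the corner-reflection
reindexing the E2 sum is `∫ conj (C (Θ U)) · C U dμ` for a bounded measurable `C` depending only on the
links of `P ∪ M`, and `wilsonExpectation_oddReflectionPositive` applies. -/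
example :
    ∀ (G : Type) [Group G] [TopologicalSpace G] [IsTopologicalGroup G] [CompactSpace G]
      [MeasurableSpace G] [BorelSpace G] (r : LatticeRep G) (β : ℝ) (L : ℕ) (a lam : ℝ)
      (m : {q : Fin 4 × Fin 4 // q.1 < q.2} → ℝ), 0 ≤ β → 1 ≤ L → 0 < a →
      (SchwingerFamily.toLabelled
        ((fun n => ∑ q : Fin n → {q : Fin 4 × Fin 4 // q.1 < q.2},
            ∑ x ∈ Fintype.piFinset (fun k => if (q k).1.1 = 0 then box 4 L
                else (box 4 L).filter (fun y => 1 - (L : ℤ) ≤ y 0)),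
              (((lam ^ n * ∫ U, ∏ k, (torusPlaquette r (2 * L + 1) (q k).1.1 (q k).1.2 (x k) U - m (q k))
                  ∂(wilsonMeasure r.ρ β : Measure (GaugeConfig 4 (2 * L + 1) G)) : ℝ) : ℂ)) •
                LabelledSchwingerFamily.evalAt (fun k => a • (siteToE (x k) +
                  (2⁻¹ : ℝ) • (EuclideanSpace.single (q k).1.1 (1 : ℝ) + EuclideanSpace.single (q k).1.2 (1 : ℝ)
                    - EuclideanSpace.single 0 (1 : ℝ))))) :
          SchwingerFamily (EuclideanSpace ℝ (Fin 4)))).IsReflectionPositive :=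
  rpBlock_reflectionPositive

end Summit.QuantumFields.YangMills.Cruxes.HypercubicLimit.ConditionalMeanTelescoping

end
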